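import Mathlib
import Summits.ValiantsHypothesis.ValiantsHypothesis.Theorems.TriangularDimersDivisionEasy.Negative.Basic
import Summits.ValiantsHypothesis.ValiantsHypothesis.Theorems.TriangularDimersDivisionEasy.Negative.Gadget

/-!
# `TriangularDimersDivisionEasy` — negative-side toolkit 3a: placing the gadget in the rhombus

Crux `stmt-ValiantsHypothesis-5067` (`Theses.DivisionGap.TriangularDimersDivisionEasy`, route
DivisionGap).  Standing disprover (cdisprove gen 1); geometry of the load-bearing lemma
`false_without_division` (Valiant 1980, Thm 1, for the rhombus).

A copy of the radius-3 edge ball (`Gadget.lean`) is placed in `R_n = Fin n × Fin n` with its centre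
edge on a prescribed lattice edge, directly (`o = false`, centre edge in direction `(1,0)`) or
transposed (`o = true`, direction `(0,1)`): `place`, `Valid`, `vtx`, `InBall`; integer coordinates
`zof` identify the crux's adjacency with the lattice adjacency (`adj_iff_adjZ`, `adj_vtx_iff`), and a
lattice neighbour of an interior placed vertex stays in the placed ball (`inBall_of_adj_interior`).
Continued in `Gluing.lean` (reading a cover inside the ball and regluing).
[folklore]
-/

namespace Summit.ValiantsHypothesis.ValiantsHypothesis.Theorems.TriangularDimersDivisionEasy.Negative

open scoped BigOperators

set_option linter.dupNamespace false

noncomputable section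

open Classical

variable {n : ℕ}

/-! ## Integer coordinates of rhombus vertices -/

/-- Integer coordinates of a vertex of `R_n`. [folklore] -/
def zof (v : Vtx n) : ℤ × ℤ := (((v.1 : ℕ) : ℤ), ((v.2 : ℕ) : ℤ))

/-- Integer coordinates determine the vertex. [folklore] -/
theorem zof_injective : Function.Injective (zof (n := n)) := by
  intro v w h
  simp only [zof, Prod.mk.injEq, Nat.cast_inj] at h
  exact Prod.ext (Fin.ext h.1) (Fin.ext h.2)

/-- The crux's adjacency is the lattice adjacency of the integer coordinates. [folklore] -/
theorem adj_iff_adjZ (v w : Vtx n) : Adj v w ↔ adjZ (zof v) (zof w) = true := by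
  rw [adjZ_iff]
  simp only [Adj, zof]
  omega

/-- A lattice neighbour differs by one of the six directions. [folklore] -/
theorem exists_dir_of_adjZ {p q : ℤ × ℤ} (h : adjZ p q = true) :
    ∃ d ∈ dirs, q = (p.1 + d.1, p.2 + d.2) := by
  obtain ⟨q1, q2⟩ := q
  rw [adjZ_iff] at h
  dsimp only at h
  rcases h with ⟨h1, h2⟩ | ⟨h1, h2⟩ | ⟨h1, h2⟩ | ⟨h1, h2⟩ | ⟨h1, h2⟩ | ⟨h1, h2⟩
  · exact ⟨(1, 0), by decide, Prod.ext (by dsimp only; omega) (by dsimp only; omega)⟩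
  · exact ⟨(-1, 0), by decide, Prod.ext (by dsimp only; omega) (by dsimp only; omega)⟩
  · exact ⟨(0, 1), by decide, Prod.ext (by dsimp only; omega) (by dsimp only; omega)⟩
  · exact ⟨(0, -1), by decide, Prod.ext (by dsimp only; omega) (by dsimp only; omega)⟩
  · exact ⟨(1, -1), by decide, Prod.ext (by dsimp only; omega) (by dsimp only; omega)⟩
  · exact ⟨(-1, 1), by decide, Prod.ext (by dsimp only; omega) (by dsimp only; omega)⟩

/-! ## Placement -/

/-- Integer coordinates of offset `p` placed with centre `c`, directly or transposed. [folklore] -/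
def place (o : Bool) (c : ℤ × ℤ) (p : ℤ × ℤ) : ℤ × ℤ :=
  if o then (c.1 + p.2, c.2 + p.1) else (c.1 + p.1, c.2 + p.2)

/-- Placement (direct or transposed translation) preserves lattice adjacency. [folklore] -/
theorem adjZ_place (o : Bool) (c p q : ℤ × ℤ) : adjZ (place o c p) (place o c q) = adjZ p q := by
  rw [Bool.eq_iff_iff, adjZ_iff, adjZ_iff]
  cases o <;> simp [place] <;> omega

/-- Placement is injective. [folklore] -/
theorem place_injective (o : Bool) (c : ℤ × ℤ) : Function.Injective (place o c) := by
  intro p q h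
  cases o <;> simp [place, Prod.ext_iff] at h <;> exact Prod.ext (by omega) (by omega)

/-- Placement commutes with adding a direction (swapped if transposed). [folklore] -/
theorem place_add_dir (o : Bool) (c p d : ℤ × ℤ) :
    ((place o c p).1 + (if o then d.2 else d.1), (place o c p).2 + (if o then d.1 else d.2)) =
      place o c (p.1 + d.1, p.2 + d.2) := by
  cases o <;> simp [place] <;> constructor <;> ring

/-- Swapping the coordinates of a direction gives a direction. [folklore] -/
theorem swap_mem_dirs : ∀ d ∈ dirs, (d.2, d.1) ∈ dirs := by decide

/-- Coordinate ranges of the ball. [folklore] -/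
theorem coord_bounds : ∀ i ∈ List.range 44,
    -3 ≤ (coord i).1 ∧ (coord i).1 ≤ 4 ∧ -3 ≤ (coord i).2 ∧ (coord i).2 ≤ 3 := by decide

/-- Distinct ball indices have distinct coordinates. [folklore] -/
theorem coord_injective {i j : ℕ} (hi : i < 44) (hj : j < 44) (h : coord i = coord j) : i = j := by
  unfold coord at h
  rw [List.getD_eq_getElem?_getD, List.getD_eq_getElem?_getD,
    List.getElem?_eq_getElem (by rw [coordL_length]; exact hi),
    List.getElem?_eq_getElem (by rw [coordL_length]; exact hj), Option.getD_some, Option.getD_some] at h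
  exact (List.Nodup.getElem_inj_iff coordL_nodup).1 h

/-- A valid centre: the whole placed ball lies in `[0,n)²`. [folklore] -/
def Valid (n : ℕ) (o : Bool) (c : ℤ × ℤ) : Prop :=
  ∀ i < 44, 0 ≤ (place o c (coord i)).1 ∧ (place o c (coord i)).1 < n ∧
    0 ≤ (place o c (coord i)).2 ∧ (place o c (coord i)).2 < n

/-- Coordinate bounds ensuring a direct placement lies inside `R_n`. [folklore] -/
theorem valid_of_bounds_false {c : ℤ × ℤ} (h1 : 3 ≤ c.1) (h2 : c.1 + 4 < n) (h3 : 3 ≤ c.2) (h4 : c.2 + 3 < n) :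
    Valid n false c := by
  intro i hi
  obtain ⟨b1, b2, b3, b4⟩ := coord_bounds i (List.mem_range.2 hi)
  simp only [place, Bool.false_eq_true, ↓reduceIte]
  omega

/-- Coordinate bounds ensuring a transposed placement lies inside `R_n`. [folklore] -/
theorem valid_of_bounds_true {c : ℤ × ℤ} (h1 : 3 ≤ c.1) (h2 : c.1 + 3 < n) (h3 : 3 ≤ c.2) (h4 : c.2 + 4 < n) :
    Valid n true c := by
  intro i hi
  obtain ⟨b1, b2, b3, b4⟩ := coord_bounds i (List.mem_range.2 hi)
  simp only [place, ↓reduceIte]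
  omega

/-- The vertex of `R_n` at offset `i` of the placed ball (junk unless the centre is valid). [folklore] -/
def vtx (hn : 0 < n) (o : Bool) (c : ℤ × ℤ) (i : ℕ) : Vtx n :=
  (⟨(place o c (coord i)).1.toNat % n, Nat.mod_lt _ hn⟩, ⟨(place o c (coord i)).2.toNat % n, Nat.mod_lt _ hn⟩)

section Placed

variable (hn : 0 < n) (o : Bool) (c : ℤ × ℤ)

/-- Coordinates of a placed vertex (valid centre). [folklore] -/
theorem zof_vtx (hV : Valid n o c) {i : ℕ} (hi : i < 44) : zof (vtx hn o c i) = place o c (coord i) := by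
  obtain ⟨h1, h2, h3, h4⟩ := hV i hi
  simp only [zof, vtx]
  have e1 : ((place o c (coord i)).1.toNat % n : ℕ) = (place o c (coord i)).1.toNat :=
    Nat.mod_eq_of_lt (by omega)
  have e2 : ((place o c (coord i)).2.toNat % n : ℕ) = (place o c (coord i)).2.toNat :=
    Nat.mod_eq_of_lt (by omega)
  rw [e1, e2, Int.toNat_of_nonneg h1, Int.toNat_of_nonneg h3]

/-- Placed vertices of distinct indices are distinct (valid centre). [folklore] -/
theorem vtx_inj (hV : Valid n o c) {i j : ℕ} (hi : i < 44) (hj : j < 44)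
    (h : vtx hn o c i = vtx hn o c j) : i = j := by
  have := congrArg zof h
  rw [zof_vtx hn o c hV hi, zof_vtx hn o c hV hj] at this
  exact coord_injective hi hj (place_injective o c this)

/-- Placed vertices are adjacent in `R_n` iff their indices are adjacent in the ball. [folklore] -/
theorem adj_vtx_iff (hV : Valid n o c) {i j : ℕ} (hi : i < 44) (hj : j < 44) :
    Adj (vtx hn o c i) (vtx hn o c j) ↔ adjI i j = true := by
  rw [adj_iff_adjZ, zof_vtx hn o c hV hi, zof_vtx hn o c hV hj, adjZ_place, adjI_spec hi hj]

/-- Membership in the placed ball. [folklore] -/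
def InBall (x : Vtx n) : Prop := ∃ i, i < 44 ∧ vtx hn o c i = x

/-- Placed vertices lie in the placed ball. [folklore] -/
theorem inBall_vtx {i : ℕ} (hi : i < 44) : InBall hn o c (vtx hn o c i) := ⟨i, hi, rfl⟩

/-- A lattice neighbour of an INTERIOR placed vertex lies in the placed ball. [folklore] -/
theorem inBall_of_adj_interior (hV : Valid n o c) {i : ℕ} (hi : i < 44) (hb : i ∉ bdryI) {y : Vtx n}
    (h : Adj (vtx hn o c i) y) : InBall hn o c y := by
  rw [adj_iff_adjZ, zof_vtx hn o c hV hi] at h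
  obtain ⟨d, hd, hy⟩ := exists_dir_of_adjZ h
  -- the offset direction: `d` itself, or `d` swapped if the placement is transposed
  set d' : ℤ × ℤ := if o then (d.2, d.1) else d with hd'
  have hd'mem : d' ∈ dirs := by
    simp only [d']; split_ifs
    · exact swap_mem_dirs d hd
    · exact hd
  have hstep : stepI i d' < 44 := stepI_lt_of_not_mem_bdryI i (List.mem_range.2 hi) hb d' hd'mem
  refine ⟨stepI i d', hstep, zof_injective ?_⟩
  rw [zof_vtx hn o c hV hstep, coord_stepI hi hd'mem hstep, hy, ← place_add_dir]
  simp only [d']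
  cases o <;> simp

end Placed

end

end Summit.ValiantsHypothesis.ValiantsHypothesis.Theorems.TriangularDimersDivisionEasy.Negative
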